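import Summits.Ventures.AbcSig.Rows.XTemplateC2a
import Summits.Ventures.AbcSig.Rows.C2aL179A0S

/-!
# Venture AbcSig — ROW `C2aL179A0SAB`: `179^m·xⁿ + yⁿ = z²` (second distribution, by symmetry), class `a = 0`, over the level files 5728 (ordinary tree certificates) and 358 (ordinary tree certificates) (GENERATED by p-lean g5 `gen5/c2arow4.py`)

HONEST FRAMING. A row of a COMPUTATION cell (`pub-abcsig`); a CONDITIONAL theorem, no claim on ABC or any summit.
Hypotheses: `BS04Package` (CITED: [BS04] Lemma 3.3 + (3.1) + Lemma 4.2); `DataComplete` at both levels and `RefinesCPSymAll` at the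
norm-form level(s) (COMPUTED: certified engine-1 level files; `Sieve/CharpolyCert.lean` / `Sieve/CharpolyTwist.lean`); KERNEL SIEVE DISCHARGES on re-based presentations (`Levels/N…RB.lean`, `Recipes/SieveDischarge.lean`) under the COMPUTED hypotheses `hRB_… : ∀ f, Matches f orbit → Matches f rb` for the pairs 5728.9 @ 13, 5728.10 @ 13;
and the listed per-orbit exclusions `hX_…` (CITED: the row of record's module closures — M4 Kraus / M6 / M8 / [BS04, Prop 4.4/4.6] as its R3
names them; nothing of those is checked here). Exponent range: prime `n ≥ 11`, `n ≠ 179`, n ∉ [11]; `B = 2^0·179^m`, `1 ≤ m < n`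
(RULING H1 reduced exponents).
S-variant (p-lean g5): same statement as Rows/C2aL179A0.lean; the residual pair(s) 5728:10:13, 5728:9:13 (N:orbit:n), closed in the row of record by the certified prime-ideal sieve (no module), are discharged IN THE KERNEL on a re-based presentation (Levels/N5728RB.lean) instead of being cited.
Row of record: `census/rows/C2a/C2a-l179-a0.md` (sha16 `49e94fe893d9fefe`; row of record R8-signed (see its R8 cell)).
-/

namespace Summit.Ventures.AbcSig

/-- Row `C2aL179A0SAB`: `a = 0`, second distribution `(179^m, 1)` — the first with `x, y` swapped (`IsPrimitiveSolution.swap`). -/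
theorem xrow_C2aL179A0SAB (M : NewformModel) (hP : M.BS04Package)
    (hRB_orbit_5728_9 : ∀ f : M.Form 5728, M.Matches f orbit_5728_9 → M.Matches f rb_5728_9)
    (hRB_orbit_5728_10 : ∀ f : M.Form 5728, M.Matches f orbit_5728_10 → M.Matches f rb_5728_10)
    (hD5728 : M.DataComplete 5728 level5728Orbits)
    (hD358 : M.DataComplete 358 level358Orbits)
    (n : ℕ) (hn : n.Prime) (hmin : 11 ≤ n) (hnℓ : n ≠ 179) (hres : n ∉ ([11] : List ℕ)) (m : ℕ) (hm : 1 ≤ m) (hmn : m < n)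
    (x y z : ℤ) (hxy1 : x * y ≠ 1) (hxy2 : x * y ≠ -1) : ¬ IsPrimitiveSolution (179 ^ m) (2 ^ 0) 1 n x y z := by
  intro h
  have h' : IsPrimitiveSolution 1 (2 ^ 0 * 179 ^ m) 1 n y x z := by simpa only [pow_zero, one_mul] using h.swap
  exact xrow_C2aL179A0S M hP hRB_orbit_5728_9 hRB_orbit_5728_10 hD5728 hD358 n hn hmin hnℓ hres m hm hmn  y x z (by rwa [mul_comm]) (by rwa [mul_comm]) h'

end Summit.Ventures.AbcSig
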